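import Mathlib.LinearAlgebra.FreeModule.PID
import Mathlib.LinearAlgebra.Dimension.FreeAndStrongRankCondition
import Literature.NumberTheory.Automorphic.BrandtXi
import HarnessLib

/-!
# Eigen-lines in the Brandt module: multiplicity one ⇒ `eigenLattice = ℤ ∙ φ` and `ξ ≥ 1`

Topic `NumberTheory/Automorphic`; proved theorems plus one definition (`Brandt.eigenSpace`), over the
abstract layer of `Literature/NumberTheory/Automorphic/BrandtXi.lean` (`Brandt.eigenLattice`,
`Brandt.xi`, `brandtXi`). Written while auditing the named fact
`Literature.NumberTheory.Automorphic.PollackWeston2011.thm_6_8_ellipticCurve`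
(`PollackWestonCongruence.lean`; Pollack–Weston, Compositio Math. 147 (2011), Thm. 6.8): that fact is
NOT discharged anywhere — its printed proof (§6.5) needs Kohel's isomorphism
`Pic(X_{N⁺,N⁻}) ⊗ 𝒪 ≅ 𝒳_r(N⁺r, N⁻/r)` (Prop. 6.5), the monodromy/component-group comparison of
Prop. 6.6 (Grothendieck, Khare) and Ribet–Takahashi's theorem [RT, T], none of which exists in Mathlib
or `Literature/`. What is proved here is the algebra behind identification (iv) of that file's module
docstring ("`M^f ∩ Pic` is a saturated line `ℤ φ`, so `ξ = ⟨φ, φ⟩ = Σ_i w_i φ_i²` is the honest value,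
and it is `≥ 1`"), which is also the "⟨φ, φ⟩ ≥ 1 for free" of route `ABC/DefiniteXi`:

* `exists_eq_span_singleton_of_ne_bot` : a non-zero `ℤ`-submodule of `ℤ^ι` (`ι` finite) any two of
  whose elements are `ℤ`-linearly dependent is a line `ℤ ∙ φ`, `φ ≠ 0` (submodules of `ℤ^ι` are free
  of finite rank, Mathlib `Submodule.nonempty_basis_of_pid`; the rank is forced to be `1`);
  `exists_int_smul_eq_of_rat_smul_eq`, `exists_nat_smul_eq_intCast` (clearing denominators).
* `Brandt.eigenSpace K N T λ` : the common eigenspace `{v ∈ K^ι : T(p) v = λ(p) v, p prime, p ∤ N}`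
  over a field `K` (the space `M^f ⊗ ℚ` of Pollack–Weston §2.1, resp. its base change), with
  `Brandt.intCast_mem_eigenSpace_iff` (`ℤ^ι ∩ eigenSpace = eigenLattice`).
* `Brandt.exists_eigenLattice_eq_span_of_finrank_eigenSpace_eq_one` : **multiplicity one ⇒ line**:
  if the rational eigenspace is one-dimensional (what Jacquet–Langlands + strong multiplicity one
  give for `λ = (a_p(E))`, `E` of conductor `N⁺N⁻` — not proved here), the eigen-lattice is `ℤ ∙ φ`
  with `φ ≠ 0`; hence `Brandt.xi w (eigenLattice …) = Σ_i w_i φ_i²` (`Brandt.xi_eq_sum`);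
* `Brandt.xi_pos_of_eq_span`, `Brandt.one_le_xi_of_finrank_eigenSpace_eq_one`,
  `one_le_brandtXi_of_forall` : `ξ ≥ 1` as soon as the weights are positive.

No named facts. Mathlib searched: `finrank_eq_one_iff'`, `Submodule.nonempty_basis_of_pid`,
`Module.End.eigenspace` (one endomorphism over a field — not the simultaneous integral eigen-lattice
of a family of integer matrices needed here).

## References

* R. Pollack, T. Weston, *On anticyclotomic μ-invariants of modular forms*, Compositio Math. 147
  (2011), §2.1 (`M^f` free of rank one, `ξ_f = ⟨g_f, g_f⟩`), Thm. 6.8 [PollackWeston2011].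
* B. H. Gross, *Heights and the special values of L-series* (1987), §§1–4 [Gross1987].
-/

noncomputable section

open scoped BigOperators Matrix

namespace Literature.NumberTheory.Automorphic

/-! ### Rank-one sublattices of `ℤ^ι` are lines -/

section Lattice

variable {ι : Type*} [Finite ι]

/-- A non-zero `ℤ`-submodule `L ⊆ ℤ^ι` (`ι` finite) in which any two elements are `ℤ`-linearly
dependent is a line: `L = ℤ ∙ φ` for some `φ ≠ 0`. (Submodules of `ℤ^ι` are free of finite rank
since `ℤ` is a PID; the dependence hypothesis rules out rank `≥ 2`, `L ≠ ⊥` rules out rank `0`.)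
[folklore] -/
theorem exists_eq_span_singleton_of_ne_bot (L : Submodule ℤ (ι → ℤ)) (hne : L ≠ ⊥)
    (hdep : ∀ v ∈ L, ∀ w ∈ L, ∃ a b : ℤ, (a ≠ 0 ∨ b ≠ 0) ∧ a • v = b • w) :
    ∃ φ : ι → ℤ, φ ≠ 0 ∧ L = ℤ ∙ φ := by
  obtain ⟨n, ⟨b⟩⟩ := Submodule.nonempty_basis_of_pid (Pi.basisFun ℤ ι) L
  rcases n with _ | _ | n
  · -- rank 0: `L = ⊥`
    haveI : Nontrivial L := Submodule.nontrivial_iff_ne_bot.mpr hne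
    exact (b.index_nonempty.some).elim0
  · -- rank 1: `L = ℤ ∙ b 0`
    refine ⟨(b 0 : ι → ℤ), fun h0 => b.ne_zero 0 (Subtype.ext h0), le_antisymm ?_ ?_⟩
    · intro x hx
      have hsum := b.sum_repr ⟨x, hx⟩
      rw [Fin.sum_univ_one] at hsum
      have hx' : x = (b.repr ⟨x, hx⟩ 0) • (b 0 : ι → ℤ) := by
        have := congrArg Subtype.val hsum
        simpa using this.symm
      rw [hx']
      exact Submodule.smul_mem _ _ (Submodule.mem_span_singleton_self _)
    · rw [Submodule.span_le, Set.singleton_subset_iff]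
      exact (b 0).2
  · -- rank ≥ 2: contradicts the dependence of `b 0` and `b 1`
    exfalso
    obtain ⟨a, c, hac, h⟩ := hdep _ (b 0).2 _ (b 1).2
    have h' : a • b 0 = c • b 1 := Subtype.ext (by simpa using h)
    have hrepr := congrArg b.repr h'
    simp only [map_smul, Module.Basis.repr_self] at hrepr
    have h0 := congrArg (fun f => f 0) hrepr
    have h1 := congrArg (fun f => f 1) hrepr
    simp only [Finsupp.smul_single, smul_eq_mul, mul_one, Finsupp.single_eq_same] at h0 h1
    rw [Finsupp.single_eq_of_ne (zero_ne_one : (0 : Fin (n + 2)) ≠ 1)] at h0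
    rw [Finsupp.single_eq_of_ne (one_ne_zero : (1 : Fin (n + 2)) ≠ 0)] at h1
    rcases hac with ha | hc
    · exact ha h0
    · exact hc h1.symm

omit [Finite ι] in
/-- A rational linear dependence between two integer vectors can be cleared of denominators.
[folklore] -/
theorem exists_int_smul_eq_of_rat_smul_eq {v w : ι → ℤ} {a c : ℚ} (hac : a ≠ 0 ∨ c ≠ 0)
    (h : a • (fun i => (v i : ℚ)) = c • (fun i => (w i : ℚ))) :
    ∃ A C : ℤ, (A ≠ 0 ∨ C ≠ 0) ∧ A • v = C • w := by
  refine ⟨a.num * c.den, c.num * a.den, ?_, ?_⟩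
  · rcases hac with ha | hc
    · exact Or.inl (mul_ne_zero (Rat.num_ne_zero.mpr ha) (Int.natCast_ne_zero.mpr c.den_nz))
    · exact Or.inr (mul_ne_zero (Rat.num_ne_zero.mpr hc) (Int.natCast_ne_zero.mpr a.den_nz))
  · funext i
    have hi := congrFun h i
    simp only [Pi.smul_apply, smul_eq_mul] at hi
    -- multiply `a v_i = c w_i` by `a.den * c.den`
    have key : ((a.num * c.den : ℤ) : ℚ) * v i = ((c.num * a.den : ℤ) : ℚ) * w i := by
      have ha' : (a.num : ℚ) = a * a.den := (Rat.mul_den_eq_num a).symm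
      have hc' : (c.num : ℚ) = c * c.den := (Rat.mul_den_eq_num c).symm
      push_cast
      rw [ha', hc']
      calc a * ↑a.den * ↑c.den * (v i : ℚ) = (a * (v i : ℚ)) * (a.den * c.den) := by ring
        _ = (c * (w i : ℚ)) * (a.den * c.den) := by rw [hi]
        _ = c * ↑c.den * ↑a.den * (w i : ℚ) := by ring
    have : ((a.num * c.den * v i : ℤ) : ℚ) = ((c.num * a.den * w i : ℤ) : ℚ) := by
      push_cast
      push_cast at key
      exact key
    simpa [Pi.smul_apply, smul_eq_mul] using (Int.cast_injective this : a.num * c.den * v i = _)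

/-- A family of rationals indexed by a finite type has a common denominator: some positive integer
multiple of it is integral. [folklore] -/
theorem exists_nat_smul_eq_intCast (v : ι → ℚ) :
    ∃ D : ℕ, D ≠ 0 ∧ ∃ w : ι → ℤ, (fun i => (w i : ℚ)) = (D : ℚ) • v := by
  classical
  cases nonempty_fintype ι
  refine ⟨∏ j, (v j).den, ?_, ?_⟩
  · exact Finset.prod_ne_zero_iff.mpr fun j _ => (v j).den_nz
  · refine ⟨fun i => (∏ j ∈ Finset.univ.erase i, ((v j).den : ℤ)) * (v i).num, ?_⟩
    funext i
    simp only [Pi.smul_apply, smul_eq_mul]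
    rw [← Finset.prod_erase_mul _ _ (Finset.mem_univ i)]
    push_cast
    rw [mul_assoc, mul_comm ((v i).den : ℚ) (v i), Rat.mul_den_eq_num]

end Lattice

/-! ### The rational (or `K`-) eigenspace and the eigen-lattice -/

namespace Brandt

variable {ι : Type*} [Fintype ι]

/-- The **common eigenspace over a field `K`** of the integer matrices `T p` (`p` prime, `p ∤ N`)
for the eigenvalue system `λ`: `{v ∈ K^ι : T(p) v = λ(p) v for all primes p ∤ N}` — for `K = ℚ`
(resp. `ℚ_p`, `ℂ`) the space `M^f ⊗ ℚ` of Pollack–Weston 2011 §2.1 whose one-dimensionality is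
the multiplicity-one input; its integral points form `eigenLattice N T λ`
(`intCast_mem_eigenSpace_iff`). [cite: PollackWeston2011, §2.1] -/
def eigenSpace (K : Type*) [Field K] (N : ℕ) (T : ℕ → Matrix ι ι ℤ) (lam : ℕ → ℤ) :
    Submodule K (ι → K) where
  carrier := {v | ∀ p : ℕ, p.Prime → ¬ p ∣ N →
    ((T p).map (Int.castRingHom K)) *ᵥ v = (lam p : K) • v}
  add_mem' {v v'} hv hv' p hp hpN := by
    rw [Matrix.mulVec_add, hv p hp hpN, hv' p hp hpN, smul_add]
  zero_mem' p hp hpN := by rw [Matrix.mulVec_zero, smul_zero]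
  smul_mem' c {v} hv p hp hpN := by
    rw [Matrix.mulVec_smul, hv p hp hpN, smul_comm]

/-- Membership in the `K`-eigenspace (definitional). [folklore] -/
theorem mem_eigenSpace_iff {K : Type*} [Field K] {N : ℕ} {T : ℕ → Matrix ι ι ℤ} {lam : ℕ → ℤ}
    {v : ι → K} :
    v ∈ eigenSpace K N T lam ↔ ∀ p : ℕ, p.Prime → ¬ p ∣ N →
      ((T p).map (Int.castRingHom K)) *ᵥ v = (lam p : K) • v :=
  Iff.rfl

/-- The image in `K^ι` of an integer vector `v` lies in the `K`-eigenspace iff `v` lies in the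
eigen-lattice (`K` of characteristic zero): `ℤ^ι ∩ (M^f ⊗ K) = M^f`. [folklore] -/
theorem intCast_mem_eigenSpace_iff {K : Type*} [Field K] [CharZero K] {N : ℕ}
    {T : ℕ → Matrix ι ι ℤ} {lam : ℕ → ℤ} {v : ι → ℤ} :
    (fun i => (v i : K)) ∈ eigenSpace K N T lam ↔ v ∈ eigenLattice N T lam := by
  rw [mem_eigenSpace_iff, mem_eigenLattice_iff]
  refine forall₃_congr fun p _ _ => ?_
  have hcast : ((T p).map (Int.castRingHom K)) *ᵥ (fun i => (v i : K)) =
      fun i => (((T p) *ᵥ v) i : K) := by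
    funext i
    exact (RingHom.map_mulVec (Int.castRingHom K) (T p) v i).symm
  rw [hcast]
  constructor
  · intro h
    funext i
    have hi := congrFun h i
    simp only [Pi.smul_apply, smul_eq_mul] at hi
    exact_mod_cast hi
  · intro h
    funext i
    have hi := congrFun h i
    simp only [Pi.smul_apply, smul_eq_mul] at hi ⊢
    exact_mod_cast hi

/-- The eigen-lattice is a line as soon as it is non-zero and any two of its elements are
`ℤ`-linearly dependent (rank one). [folklore] -/
theorem exists_eigenLattice_eq_span {N : ℕ} {T : ℕ → Matrix ι ι ℤ} {lam : ℕ → ℤ}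
    (hne : eigenLattice N T lam ≠ ⊥)
    (hdep : ∀ v ∈ eigenLattice N T lam, ∀ w ∈ eigenLattice N T lam,
      ∃ a b : ℤ, (a ≠ 0 ∨ b ≠ 0) ∧ a • v = b • w) :
    ∃ φ : ι → ℤ, φ ≠ 0 ∧ eigenLattice N T lam = ℤ ∙ φ :=
  exists_eq_span_singleton_of_ne_bot _ hne hdep

/-- **Multiplicity one ⇒ the eigen-lattice is a line.** If the rational common eigenspace of the
matrices `T p` (`p` prime, `p ∤ N`) for `λ` is one-dimensional, then
`eigenLattice N T λ = ℤ ∙ φ` for some `φ ≠ 0` (so `Brandt.xi` takes its honest value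
`Σ_i w_i φ_i²`, `Brandt.xi_eq_sum`). This is the passage "`M^f` is free of rank one; let `g_f` be a
generator" of Pollack–Weston 2011 §2.1, over `ℤ`. [cite: PollackWeston2011, §2.1] -/
theorem exists_eigenLattice_eq_span_of_finrank_eigenSpace_eq_one {N : ℕ} {T : ℕ → Matrix ι ι ℤ}
    {lam : ℕ → ℤ} (h : Module.finrank ℚ (eigenSpace ℚ N T lam) = 1) :
    ∃ φ : ι → ℤ, φ ≠ 0 ∧ eigenLattice N T lam = ℤ ∙ φ := by
  obtain ⟨v₀, hv₀, hspan⟩ := finrank_eq_one_iff'.mp h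
  -- an integral non-zero eigenvector: clear the denominators of `v₀`
  obtain ⟨D, hD, w, hw⟩ := exists_nat_smul_eq_intCast (ι := ι) (v₀ : ι → ℚ)
  have hwmem : w ∈ eigenLattice N T lam := by
    rw [← intCast_mem_eigenSpace_iff (K := ℚ), hw]
    exact Submodule.smul_mem _ _ v₀.2
  have hwne : w ≠ 0 := by
    intro hw0
    rw [hw0] at hw
    have hzero : (D : ℚ) • (v₀ : ι → ℚ) = 0 := by
      rw [← hw]; funext i; simp
    rcases smul_eq_zero.mp hzero with hD' | hv
    · exact hD (by exact_mod_cast hD')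
    · exact hv₀ (Subtype.ext hv)
  refine exists_eigenLattice_eq_span (fun hbot => hwne ?_) fun v hv v' hv' => ?_
  · rw [hbot] at hwmem
    exact (Submodule.mem_bot ℤ).mp hwmem
  · -- both `v` and `v'` are rational multiples of `v₀`
    have hvS : (fun i => (v i : ℚ)) ∈ eigenSpace ℚ N T lam := intCast_mem_eigenSpace_iff.mpr hv
    have hv'S : (fun i => (v' i : ℚ)) ∈ eigenSpace ℚ N T lam := intCast_mem_eigenSpace_iff.mpr hv'
    obtain ⟨c, hc⟩ := hspan ⟨_, hvS⟩
    obtain ⟨c', hc'⟩ := hspan ⟨_, hv'S⟩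
    have hcv : (fun i => (v i : ℚ)) = c • (v₀ : ι → ℚ) := by
      have := congrArg Subtype.val hc; simpa using this.symm
    have hcv' : (fun i => (v' i : ℚ)) = c' • (v₀ : ι → ℚ) := by
      have := congrArg Subtype.val hc'; simpa using this.symm
    by_cases hc0 : c = 0
    · refine ⟨1, 0, Or.inl one_ne_zero, ?_⟩
      rw [one_smul, zero_smul]
      funext i
      have hi := congrFun hcv i
      simp only [hc0, zero_smul, Pi.zero_apply, Int.cast_eq_zero] at hi
      exact hi
    · refine exists_int_smul_eq_of_rat_smul_eq (a := c') (c := c) (Or.inr hc0) ?_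
      rw [hcv, hcv', smul_smul, smul_smul, mul_comm]

/-! ### `ξ ≥ 1` -/

/-- If the eigen-lattice is the line `ℤ ∙ φ`, `φ ≠ 0`, and all weights are positive, then
`ξ = Σ_i w_i φ_i² > 0`. [folklore] -/
theorem xi_pos_of_eq_span (w : ι → ℕ) (hw : ∀ i, 0 < w i) {L : Submodule ℤ (ι → ℤ)}
    {φ : ι → ℤ} (hφ : φ ≠ 0) (hL : L = ℤ ∙ φ) : 0 < xi w L := by
  rw [xi_eq_sum w hφ hL]
  obtain ⟨i, hi⟩ : ∃ i, φ i ≠ 0 := Function.ne_iff.mp hφ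
  refine Finset.sum_pos' (fun j _ => Nat.zero_le _) ⟨i, Finset.mem_univ i, ?_⟩
  exact Nat.mul_pos (hw i) (pow_pos (Int.natAbs_pos.mpr hi) 2)

/-- **`ξ ≥ 1` from multiplicity one**: if the rational common eigenspace for `λ` is one-dimensional
and the weights are positive, then `1 ≤ xi w (eigenLattice N T λ)` (the integer `⟨φ, φ⟩` of a
primitive generator; Pollack–Weston 2011 §2.1, Gross 1987 §3). [cite: PollackWeston2011, §2.1] -/
theorem one_le_xi_of_finrank_eigenSpace_eq_one (w : ι → ℕ) (hw : ∀ i, 0 < w i) {N : ℕ}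
    {T : ℕ → Matrix ι ι ℤ} {lam : ℕ → ℤ} (h : Module.finrank ℚ (eigenSpace ℚ N T lam) = 1) :
    1 ≤ xi w (eigenLattice N T lam) := by
  obtain ⟨φ, hφ, hL⟩ := exists_eigenLattice_eq_span_of_finrank_eigenSpace_eq_one h
  exact xi_pos_of_eq_span w hw hφ hL

end Brandt

/-! ### Consequence for `brandtXi` -/

/-- **`brandtXi ≥ 1` under multiplicity one.** If some Brandt setup of type `(N⁺, N⁻)` exists and, in
every setup, the rational eigenspace of the Brandt matrices for `λ` (primes `p ∤ N⁺N⁻`) is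
one-dimensional and the weights `w_c = #O_L(I_c)ˣ/2` are positive, then
`1 ≤ brandtXi N⁺ N⁻ λ` — the lower bound "⟨φ, φ⟩ ≥ 1" behind route `ABC/DefiniteXi`, valid without any
independence-of-choices theorem (`le_brandtXi_of_forall`). [folklore] -/
theorem one_le_brandtXi_of_forall {Nplus Nminus : ℕ} {lam : ℕ → ℤ}
    (hne : Nonempty (Brandt.XiSetup Nplus Nminus))
    (h : ∀ (S : Brandt.XiSetup Nplus Nminus) [Fintype (Brandt.ClassSet S.O)],
      (∀ c, 0 < Brandt.weight S.O c) ∧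
        Module.finrank ℚ (Brandt.eigenSpace ℚ (Nplus * Nminus) (Brandt.matrix S.O) lam) = 1) :
    1 ≤ brandtXi Nplus Nminus lam := by
  classical
  refine le_brandtXi_of_forall hne fun S => ?_
  letI : Fintype (Brandt.ClassSet S.O) := Fintype.ofFinite _
  obtain ⟨hw, hrank⟩ := h S
  rw [Brandt.XiSetup.xi, Brandt.xiOfOrder_eq]
  exact Brandt.one_le_xi_of_finrank_eigenSpace_eq_one _ hw hrank

end Literature.NumberTheory.Automorphic

end
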